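import Literature.Topology.FourManifolds.FibrewiseCriticalSection
import Literature.Topology.FourManifolds.FibrewiseMorseChart
import Literature.Topology.FourManifolds.IndefiniteFoldChartAssembly
import HarnessLib

/-!
# Indefinite fold charts at nondegenerate indefinite rank-one critical points

Topic `Literature/Topology/FourManifolds`.  The real normal form of an INDEFINITE FOLD
(Baykur–Saeki 2017, §2.1, p. 6: *"a fold singularity if the map is locally given by
`(t, x₁, x₂, x₃) ↦ (t, ±x₁² ± x₂² ± x₃²)` … indefinite otherwise"*) for maps already in the
rank-one form `F = (t, f(t, w))`, `w ∈ ℝ³` (`RankOneNormalForm.lean`): if at `x` the fibre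
gradient of `f` vanishes and the fibre Hessian is nondegenerate and indefinite, then `x` is an
indefinite fold point of `F` in the chart sense of `IsSimplifiedBrokenLefschetzFibration.fold`
(`HasIndefiniteFoldChart`).  This is the parametric Morse lemma with three fibre variables,
assembled from the critical section (`FibrewiseCriticalSection.lean`), the fibrewise Morse
coordinates (`FibrewiseMorseChart.lean`, after a smooth cut-off in the parameter) and the chart
assembly (`IndefiniteFoldChartAssembly.lean`); the index `σ ∈ {1, 2}` of the fibre Hessian is
read off from Sylvester's law.  Everything is PROVED; no named fact.

* `fibrePart : ℝ⁴ →L ℝ³`, `fibredMap f : ℝ⁴ → ℝ²`, `q ↦ (q₀, f (q₀, (q₁, q₂, q₃)))`;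
* `hasIndefiniteFoldChart_fibredMap` — **the fold chart**.

## References

* R. İ. Baykur, O. Saeki, *Simplifying indefinite fibrations on 4-manifolds*, arXiv:1705.11169
  (Trans. AMS 376, 2023), §2.1. [BaykurSaeki2017]
* M. W. Hirsch, *Differential Topology* (1976), Ch. 6 §1 (Morse lemma). [HirschDT1976]
-/

noncomputable section

-- Instance search through the tower `E →L[ℝ] E →L[ℝ] ℝ` needs one more level of pending depth,
-- as in `MorseLemma.lean` and `HadamardLemma.lean`.
set_option maxSynthPendingDepth 2

open Set Function Filter Module
open scoped Topology ContDiff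

namespace Literature.Topology.FourManifolds

/-- Local notation: `𝔼 n` is the model Euclidean space `EuclideanSpace ℝ (Fin n)`. -/
local notation "𝔼 " n:arg => EuclideanSpace ℝ (Fin n)

/-! ### The fibred map `(t, f(t, w))` on `ℝ⁴ = ℝ × ℝ³` -/

/-- The fibre part `(q₁, q₂, q₃)` of `q ∈ ℝ⁴`, as a continuous linear map `ℝ⁴ → ℝ³`.
[folklore] -/
def fibrePart : 𝔼 4 →L[ℝ] 𝔼 3 :=
  ∑ i : Fin 3, (EuclideanSpace.proj i.succ : 𝔼 4 →L[ℝ] ℝ).smulRight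
    (EuclideanSpace.single i (1 : ℝ))

/-- `fibrePart q i = q (i+1)`. [folklore] -/
@[simp] theorem fibrePart_apply (q : 𝔼 4) (i : Fin 3) : fibrePart q i = q i.succ := by
  simp [fibrePart, Pi.single_apply, mul_ite]

/-- **The fibred map** of `f : ℝ × ℝ³ → ℝ`: `F q = (q₀, f (q₀, (q₁, q₂, q₃)))`. [folklore] -/
def fibredMap (f : ℝ × 𝔼 3 → ℝ) (q : 𝔼 4) : 𝔼 2 :=
  (q 0) • EuclideanSpace.single (0 : Fin 2) (1 : ℝ) +
    f (q 0, fibrePart q) • EuclideanSpace.single (1 : Fin 2) (1 : ℝ)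

/-- First component of the fibred map: `q₀`. [folklore] -/
@[simp] theorem fibredMap_apply_zero (f : ℝ × 𝔼 3 → ℝ) (q : 𝔼 4) : fibredMap f q 0 = q 0 := by
  simp [fibredMap]

/-- Second component of the fibred map: `f (q₀, (q₁, q₂, q₃))`. [folklore] -/
@[simp] theorem fibredMap_apply_one (f : ℝ × 𝔼 3 → ℝ) (q : 𝔼 4) :
    fibredMap f q 1 = f (q 0, fibrePart q) := by
  simp [fibredMap]

/-- The fibred map of a `C^∞` function is `C^∞`. [folklore] -/
theorem contDiff_fibredMap {f : ℝ × 𝔼 3 → ℝ} (hf : ContDiff ℝ ∞ f) :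
    ContDiff ℝ ∞ (fibredMap f) := by
  have h0 : ContDiff ℝ ∞ fun q : 𝔼 4 => q 0 :=
    (EuclideanSpace.proj (0 : Fin 4) : 𝔼 4 →L[ℝ] ℝ).contDiff
  unfold fibredMap
  exact (h0.smul contDiff_const).add ((hf.comp (h0.prodMk fibrePart.contDiff)).smul contDiff_const)

/-! ### Sums over the sorted Sylvester coordinates of `ℝ³` -/

/-- For index `σ = 1` the negative block is `{0}` and the positive block `{1, 2}`. [folklore] -/
theorem sum_sq_filter_one (y : 𝔼 3) :
    (- ∑ i ∈ Finset.univ.filter (fun i : Fin 3 => i.val < 1), (y i) ^ 2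
      + ∑ i ∈ Finset.univ.filter (fun i : Fin 3 => 1 ≤ i.val), (y i) ^ 2) =
      -(y 0) ^ 2 + ((y 1) ^ 2 + (y 2) ^ 2) := by
  have h1 : Finset.univ.filter (fun i : Fin 3 => i.val < 1) = {0} := by decide
  have h2 : Finset.univ.filter (fun i : Fin 3 => 1 ≤ i.val) = {1, 2} := by decide
  rw [h1, h2, Finset.sum_singleton, Finset.sum_pair (by decide)]

/-- For index `σ = 2` the negative block is `{0, 1}` and the positive block `{2}`. [folklore] -/
theorem sum_sq_filter_two (y : 𝔼 3) :
    (- ∑ i ∈ Finset.univ.filter (fun i : Fin 3 => i.val < 2), (y i) ^ 2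
      + ∑ i ∈ Finset.univ.filter (fun i : Fin 3 => 2 ≤ i.val), (y i) ^ 2) =
      -((y 0) ^ 2 + (y 1) ^ 2) + (y 2) ^ 2 := by
  have h1 : Finset.univ.filter (fun i : Fin 3 => i.val < 2) = {0, 1} := by decide
  have h2 : Finset.univ.filter (fun i : Fin 3 => 2 ≤ i.val) = {2} := by decide
  rw [h1, h2, Finset.sum_singleton, Finset.sum_pair (by decide)]

/-- The cyclic coordinate permutation `(a₀, a₁, a₂) ↦ (a₁, a₂, a₀)` of `ℝ³`. [folklore] -/
def cycle3 : 𝔼 3 →L[ℝ] 𝔼 3 :=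
  (EuclideanSpace.proj (1 : Fin 3) : 𝔼 3 →L[ℝ] ℝ).smulRight
      (EuclideanSpace.single (0 : Fin 3) (1 : ℝ)) +
    (EuclideanSpace.proj (2 : Fin 3) : 𝔼 3 →L[ℝ] ℝ).smulRight
      (EuclideanSpace.single (1 : Fin 3) (1 : ℝ)) +
    (EuclideanSpace.proj (0 : Fin 3) : 𝔼 3 →L[ℝ] ℝ).smulRight
      (EuclideanSpace.single (2 : Fin 3) (1 : ℝ))

/-- Pointwise formula for `cycle3`. [folklore] -/
theorem cycle3_apply (a : 𝔼 3) : cycle3 a = WithLp.toLp 2 ![a 1, a 2, a 0] := by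
  ext i
  fin_cases i <;> simp [cycle3]

/-- `cycle3` is injective. [folklore] -/
theorem cycle3_injective : Injective cycle3 := by
  intro a b h
  rw [cycle3_apply, cycle3_apply] at h
  have h0 := congrArg (fun v : 𝔼 3 => v 0) h
  have h1 := congrArg (fun v : 𝔼 3 => v 1) h
  have h2 := congrArg (fun v : 𝔼 3 => v 2) h
  simp at h0 h1 h2
  ext i
  fin_cases i
  · simpa using h2
  · simpa using h0
  · simpa using h1

/-! ### The cut-off family and the fibre Hessian of a translate -/

/-- **Second fibre derivatives are translation invariant**: if `g (t₀, u) = f (t₀, w₀ + u) - c`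
for all `u` then `fibreHessian g (t₀, 0) = fibreHessian f (t₀, w₀)`. [folklore] -/
theorem fibreHessian_eq_of_eq_translate {g f : ℝ × 𝔼 3 → ℝ} (hg : ContDiff ℝ ∞ g)
    (hf : ContDiff ℝ ∞ f) {t₀ : ℝ} {w₀ : 𝔼 3} {C : ℝ}
    (h : ∀ u, g (t₀, u) = f (t₀, w₀ + u) - C) :
    fibreHessian g (t₀, 0) = fibreHessian f (t₀, w₀) := by
  have h2 : (2 : WithTop ℕ∞) ≤ ∞ := WithTop.coe_le_coe.2 le_top
  ext a b
  rw [fibreHessian_apply, fibreHessian_apply,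
    ← Literature.Analysis.Calculus.fderiv_fderiv_partial_snd hg h2,
    ← Literature.Analysis.Calculus.fderiv_fderiv_partial_snd hf h2]
  set F₁ : 𝔼 3 → ℝ := fun w => f (t₀, w) with hF₁
  have hF₁s : ContDiff ℝ ∞ F₁ := Literature.Analysis.Calculus.contDiff_partial_snd hf t₀
  have hF₁d : ∀ w, HasFDerivAt F₁ (fderiv ℝ F₁ w) w := fun w =>
    ((hF₁s.differentiable (by simp)) w).hasFDerivAt
  set F₂ : 𝔼 3 → (𝔼 3 →L[ℝ] ℝ) := fderiv ℝ F₁ with hF₂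
  have hF₂d : ∀ w, HasFDerivAt F₂ (fderiv ℝ F₂ w) w := fun w =>
    (((hF₁s.fderiv_right (m := ∞) le_rfl).differentiable (by simp)) w).hasFDerivAt
  have hfun : (fun u => g (t₀, u)) = fun u => F₁ (w₀ + u) - C := funext h
  -- first derivative of the translate
  have hd1 : fderiv ℝ (fun u => F₁ (w₀ + u) - C) = fun u => F₂ (w₀ + u) := by
    funext u
    have h1 : HasFDerivAt (fun u => F₁ (w₀ + u) - C) (fderiv ℝ F₁ (w₀ + u)) u :=
      (((hF₁d (w₀ + u)).comp u ((hasFDerivAt_id u).const_add w₀)).sub_const C).congr_fderiv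
        (by simp [hF₂])
    exact h1.fderiv
  -- second derivative of the translate
  have hd2 : HasFDerivAt (fun u => F₂ (w₀ + u)) (fderiv ℝ F₂ (w₀ + 0)) 0 :=
    ((hF₂d (w₀ + 0)).comp (0 : 𝔼 3) ((hasFDerivAt_id (0 : 𝔼 3)).const_add w₀)).congr_fderiv
      (by simp)
  rw [hfun, hd1, hd2.fderiv, add_zero]

/-- **The cut-off family.**  Given the critical section `ξ` of `f` on the open `U ∋ t₀`
(`∂_w f (t, ξ t) = 0`), the family `g (t, u) = ρ(t) (f (t, ξ t + u) - f (t, ξ t))` with a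
smooth bump `ρ` supported in `U` and `≡ 1` near `t₀` is globally `C^∞`, has the zero section
critical (`g (t, 0) = 0`, `∂ᵤ g (t, 0) = 0` for ALL `t`), and equals
`f (t, ξ t + u) - f (t, ξ t)` for `t` in an open `V ∋ t₀`. [folklore] -/
theorem exists_cutoffFamily {f : ℝ × 𝔼 3 → ℝ} (hf : ContDiff ℝ ∞ f) {U : Set ℝ} (hU : IsOpen U)
    {t₀ : ℝ} (ht₀ : t₀ ∈ U) {ξ : ℝ → 𝔼 3} (hξ : ContDiffOn ℝ ∞ ξ U)
    (hcrit : ∀ t ∈ U, ∀ a : 𝔼 3, fderiv ℝ f (t, ξ t) ((0 : ℝ), a) = 0) :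
    ∃ (V : Set ℝ) (g : ℝ × 𝔼 3 → ℝ), IsOpen V ∧ t₀ ∈ V ∧ V ⊆ U ∧ ContDiff ℝ ∞ g ∧
      (∀ t, g (t, 0) = 0) ∧ (∀ (t : ℝ) (a : 𝔼 3), fderiv ℝ g (t, 0) ((0 : ℝ), a) = 0) ∧
      ∀ t ∈ V, ∀ u, g (t, u) = f (t, ξ t + u) - f (t, ξ t) := by
  obtain ⟨ρ, hρ, hρU, hρ1⟩ := Literature.Analysis.Calculus.exists_contDiff_bump_nhds hU ht₀
  obtain ⟨V, hVsub, hVo, ht₀V⟩ : ∃ V ⊆ U ∩ {t | ρ t = 1}, IsOpen V ∧ t₀ ∈ V :=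
    _root_.mem_nhds_iff.1 (Filter.inter_mem (hU.mem_nhds ht₀) hρ1)
  set g : ℝ × 𝔼 3 → ℝ := fun p => ρ p.1 * (f (p.1, ξ p.1 + p.2) - f (p.1, ξ p.1)) with hg_def
  -- global smoothness
  have hgs : ContDiff ℝ ∞ g := by
    rw [contDiff_iff_contDiffAt]
    intro p
    by_cases hp : p.1 ∈ U
    · have hξp : ContDiffAt ℝ ∞ (fun p : ℝ × 𝔼 3 => ξ p.1) p :=
        (hξ.contDiffAt (hU.mem_nhds hp)).comp p contDiffAt_fst
      exact ((hρ.comp contDiff_fst).contDiffAt).mul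
        ((hf.contDiffAt.comp p (contDiffAt_fst.prodMk (hξp.add contDiffAt_snd))).sub
          (hf.contDiffAt.comp p (contDiffAt_fst.prodMk hξp)))
    · have hp' : p.1 ∉ tsupport ρ := fun h => hp (hρU h)
      have hev : g =ᶠ[𝓝 p] fun _ => 0 := by
        have ho : IsOpen ((tsupport ρ)ᶜ ×ˢ (univ : Set (𝔼 3))) :=
          (isClosed_tsupport ρ).isOpen_compl.prod isOpen_univ
        filter_upwards [ho.mem_nhds ⟨hp', mem_univ _⟩] with q hq
        show ρ q.1 * _ = 0
        rw [image_eq_zero_of_notMem_tsupport hq.1, zero_mul]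
      exact (contDiffAt_const (c := (0 : ℝ))).congr_of_eventuallyEq hev
  refine ⟨V, g, hVo, ht₀V, fun t ht => (hVsub ht).1, hgs, fun t => by simp [hg_def], ?_, ?_⟩
  · intro t a
    have hgd : DifferentiableAt ℝ g (t, 0) := (hgs.differentiable (by simp)) _
    rw [show (((0 : ℝ), a) : ℝ × 𝔼 3) = ContinuousLinearMap.inr ℝ ℝ (𝔼 3) a by simp,
      ← ContinuousLinearMap.comp_apply,
      ← Literature.Analysis.Calculus.fderiv_partial_snd hgd]
    have hline : HasFDerivAt (fun u : 𝔼 3 => ((t, ξ t + u) : ℝ × 𝔼 3))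
        (ContinuousLinearMap.inr ℝ ℝ (𝔼 3)) 0 := by
      refine ((hasFDerivAt_const t (0 : 𝔼 3)).prodMk
        ((hasFDerivAt_id (0 : 𝔼 3)).const_add (ξ t))).congr_fderiv ?_
      refine ContinuousLinearMap.ext fun v => Prod.ext ?_ ?_ <;> simp
    have hF : HasFDerivAt (fun u : 𝔼 3 => f (t, ξ t + u))
        ((fderiv ℝ f (t, ξ t + 0)).comp (ContinuousLinearMap.inr ℝ ℝ (𝔼 3))) 0 :=
      ((hf.differentiable (by simp)) _).hasFDerivAt.comp (0 : 𝔼 3) hline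
    have hG : HasFDerivAt (fun u : 𝔼 3 => g (t, u))
        (ρ t • ((fderiv ℝ f (t, ξ t + 0)).comp (ContinuousLinearMap.inr ℝ ℝ (𝔼 3)))) 0 :=
      (hF.sub_const (f (t, ξ t))).const_mul (ρ t)
    rw [hG.fderiv]
    show ρ t * fderiv ℝ f (t, ξ t + 0) (ContinuousLinearMap.inr ℝ ℝ (𝔼 3) a) = 0
    rw [add_zero, ContinuousLinearMap.inr_apply]
    by_cases ht : t ∈ U
    · rw [hcrit t ht a, mul_zero]
    · rw [image_eq_zero_of_notMem_tsupport (fun h => ht (hρU h)), zero_mul]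
  · intro t ht u
    have hρt : ρ t = 1 := (hVsub ht).2
    simp [hg_def, hρt]

/-! ### The fold chart -/

/-- **The real normal form of an indefinite fold.**  Let `f : ℝ × ℝ³ → ℝ` be `C^∞` and let
`x ∈ ℝ⁴` be a fibrewise critical point of the fibred map `F = (q₀, f(q₀, q₁, q₂, q₃))`
(`fibreGrad f (x₀, (x₁, x₂, x₃)) = 0`) at which the fibre Hessian is nondegenerate and
indefinite (takes both signs).  Then `x` is an indefinite fold point of `F`: there are smooth
charts `φ` of `ℝ⁴` at `x` (`φ x = 0`) and `ψ` of `ℝ²` with `ψ ∘ F = (φ₀, φ₁² + φ₂² - φ₃²)`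
on the source of `φ` (`HasIndefiniteFoldChart F x`) — the parametric Morse lemma with three
fibre variables (critical section `FibrewiseCriticalSection.lean`, fibrewise Morse coordinates
`FibrewiseMorseChart.lean` after a smooth cut-off in `t`, index `σ ∈ {1, 2}` by Sylvester,
charts by `IndefiniteFoldChartAssembly.lean`).  Baykur–Saeki 2017, §2.1 (*"indefinite
otherwise"*); Hirsch 1976, Ch. 6 §1. [cite: BaykurSaeki2017, §2.1] -/
theorem hasIndefiniteFoldChart_fibredMap {f : ℝ × 𝔼 3 → ℝ} (hf : ContDiff ℝ ∞ f) {x : 𝔼 4}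
    (hcrit : fibreGrad f (x 0, fibrePart x) = 0)
    (hH : ∀ a : 𝔼 3, (∀ b, fibreHessian f (x 0, fibrePart x) a b = 0) → a = 0)
    (hneg : ∃ a : 𝔼 3, fibreHessian f (x 0, fibrePart x) a a < 0)
    (hpos : ∃ b : 𝔼 3, 0 < fibreHessian f (x 0, fibrePart x) b b) :
    HasIndefiniteFoldChart (fibredMap f) x := by
  set t₀ : ℝ := x 0 with ht₀_def
  set w₀ : 𝔼 3 := fibrePart x with hw₀_def
  have h2 : (2 : WithTop ℕ∞) ≤ ∞ := WithTop.coe_le_coe.2 le_top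
  have hsymm : ∀ a b, fibreHessian f (t₀, w₀) a b = fibreHessian f (t₀, w₀) b a := fun a b => by
    simp only [fibreHessian_apply]
    exact (hf.contDiffAt.isSymmSndFDerivAt (by simpa using h2)) _ _
  -- Step 1: the critical section
  have hH' : ∀ a : 𝔼 3, (∀ b, fderiv ℝ (fderiv ℝ f) (t₀, w₀) ((0 : ℝ), a) ((0 : ℝ), b) = 0) →
      a = 0 := fun a ha => hH a fun b => by rw [fibreHessian_apply]; exact ha b
  obtain ⟨U, hUo, ht₀U, ξ, hξ, hξ₀, hξcrit⟩ := exists_fibrewiseCriticalSection hf hcrit hH'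
  have hξcrit' : ∀ t ∈ U, ∀ a : 𝔼 3, fderiv ℝ f (t, ξ t) ((0 : ℝ), a) = 0 := fun t ht =>
    (fibreGrad_eq_zero_iff f _).1 (hξcrit t ht)
  -- Step 2: the cut-off family `g`
  obtain ⟨V, g, hVo, ht₀V, hVU, hg, hg0, hg1, hgV⟩ := exists_cutoffFamily hf hUo ht₀U hξ hξcrit'
  have hgt₀ : ∀ u, g (t₀, u) = f (t₀, w₀ + u) - f (t₀, w₀) := fun u => by
    rw [hgV t₀ ht₀V u, hξ₀]
  have hHg : fibreHessian g (t₀, 0) = fibreHessian f (t₀, w₀) :=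
    fibreHessian_eq_of_eq_translate hg hf hgt₀
  have hHgnd : ∀ a : 𝔼 3, (∀ b, fibreHessian g (t₀, 0) a b = 0) → a = 0 := by
    rw [hHg]
    exact hH
  -- Step 3: fibrewise Morse coordinates of `g`
  obtain ⟨W, y, Λ, hWo, hW₀, hys, hy0, hyd, hgy⟩ := exists_fibrewiseMorseCoords hg hg0 hg1 hHgnd
  rw [hHg] at hgy
  set σ : ℕ := sigNeg (((fibreHessian f (t₀, w₀)).toBilinForm).toQuadraticMap) with hσ
  -- Step 4: the index is `1` or `2` (Sylvester; the fibre Hessian takes both signs)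
  obtain ⟨Λ', hΛ'⟩ := exists_continuousLinearEquiv_eq_sum_sq (fibreHessian f (t₀, w₀)) hsymm hH
    (n := 3) finrank_euclideanSpace_fin
  have hσ1 : 1 ≤ σ := by
    by_contra hlt
    push Not at hlt
    have hσ0 : σ = 0 := by omega
    obtain ⟨a, ha⟩ := hneg
    have h := hΛ' a
    rw [← hσ, hσ0] at h
    have hA : Finset.univ.filter (fun i : Fin 3 => i.val < 0) = ∅ :=
      Finset.filter_false_of_mem fun i _ => by omega
    have hB : Finset.univ.filter (fun i : Fin 3 => 0 ≤ i.val) = Finset.univ :=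
      Finset.filter_true_of_mem fun i _ => Nat.zero_le _
    rw [hA, hB, Finset.sum_empty, neg_zero, zero_add] at h
    have hnn : 0 ≤ ∑ i : Fin 3, (Λ' a i) ^ 2 := Finset.sum_nonneg fun i _ => sq_nonneg _
    linarith
  have hσ2 : σ ≤ 2 := by
    by_contra hlt
    push Not at hlt
    obtain ⟨b, hb⟩ := hpos
    have h := hΛ' b
    rw [← hσ] at h
    have hA : Finset.univ.filter (fun i : Fin 3 => i.val < σ) = Finset.univ :=
      Finset.filter_true_of_mem fun i _ => by have := i.isLt; omega
    have hB : Finset.univ.filter (fun i : Fin 3 => σ ≤ i.val) = ∅ :=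
      Finset.filter_false_of_mem fun i _ => by have := i.isLt; omega
    rw [hA, hB, Finset.sum_empty, add_zero] at h
    have hnn : 0 ≤ ∑ i : Fin 3, (Λ' b i) ^ 2 := Finset.sum_nonneg fun i _ => sq_nonneg _
    linarith
  -- Step 5: data for the chart assembly
  have hPc : ∀ i : Fin 4, ContDiff ℝ ∞ fun q : 𝔼 4 => q i := fun i =>
    (EuclideanSpace.proj i : 𝔼 4 →L[ℝ] ℝ).contDiff
  have hPd : ∀ i : Fin 4,
      HasFDerivAt (fun q : 𝔼 4 => q i) (EuclideanSpace.proj i : 𝔼 4 →L[ℝ] ℝ) x :=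
    fun i => (EuclideanSpace.proj i : 𝔼 4 →L[ℝ] ℝ).hasFDerivAt
  have hVU' : ContDiffOn ℝ ∞ ξ V := hξ.mono hVU
  set c : ℝ → ℝ := fun t => f (t, ξ t) with hc_def
  have hcs : ContDiffOn ℝ ∞ c V := hf.comp_contDiffOn (contDiffOn_id.prodMk hVU')
  set ι : 𝔼 4 → ℝ × 𝔼 3 := fun q => (q 0, fibrePart q - ξ (q 0)) with hι_def
  have hV4o : IsOpen {q : 𝔼 4 | q 0 ∈ V} := hVo.preimage (hPc 0).continuous
  have hιs : ContDiffOn ℝ ∞ ι {q : 𝔼 4 | q 0 ∈ V} :=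
    (hPc 0).contDiffOn.prodMk (fibrePart.contDiff.contDiffOn.sub
      (hVU'.comp (hPc 0).contDiffOn fun q hq => hq))
  set O : Set (𝔼 4) := {q | q 0 ∈ V} ∩ ι ⁻¹' W with hO_def
  have hOo : IsOpen O := hιs.continuousOn.isOpen_inter_preimage hV4o hWo
  have hxι : ι x = (t₀, 0) := by
    show ((x 0, fibrePart x - ξ (x 0)) : ℝ × 𝔼 3) = (t₀, 0)
    rw [← ht₀_def, hξ₀, ← hw₀_def, sub_self]
  have hxO : x ∈ O := ⟨ht₀V, by show ι x ∈ W; rw [hxι]; exact hW₀⟩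
  have hOV : ∀ q ∈ O, q 0 ∈ V := fun q hq => hq.1
  -- `f = c + g ∘ ι` on `O`, and the normal form of `g`
  have hfq : ∀ q ∈ O, f (q 0, fibrePart q) = c (q 0) + g (ι q) := fun q hq => by
    rw [hgV (q 0) hq.1]
    simp [hc_def]
  -- derivative of `y ∘ ι` at `x`
  have hyD : HasFDerivAt y (fderiv ℝ y (t₀, 0)) (t₀, 0) :=
    ((hys.contDiffAt (hWo.mem_nhds hW₀)).differentiableAt (by simp)).hasFDerivAt
  have hyΛ : (fderiv ℝ y (t₀, 0)).comp (ContinuousLinearMap.inr ℝ ℝ (𝔼 3)) =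
      (Λ : 𝔼 3 →L[ℝ] 𝔼 3) := by
    rw [← Literature.Analysis.Calculus.fderiv_partial_snd hyD.differentiableAt, hyd.fderiv]
  have hξd : HasDerivAt ξ (deriv ξ t₀) t₀ :=
    ((hVU'.contDiffAt (hVo.mem_nhds ht₀V)).differentiableAt (by simp)).hasDerivAt
  set ι' : 𝔼 4 →L[ℝ] ℝ × 𝔼 3 := (EuclideanSpace.proj (0 : Fin 4) : 𝔼 4 →L[ℝ] ℝ).prod
    (fibrePart - ((1 : ℝ →L[ℝ] ℝ).smulRight (deriv ξ t₀)).comp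
      (EuclideanSpace.proj (0 : Fin 4) : 𝔼 4 →L[ℝ] ℝ)) with hι'
  have hιd : HasFDerivAt ι ι' x :=
    (hPd 0).prodMk (fibrePart.hasFDerivAt.sub (hξd.hasFDerivAt.comp x (hPd 0)))
  have hyD' : HasFDerivAt y (fderiv ℝ y (t₀, 0)) (ι x) := by
    rw [hxι]
    exact hyD
  have hyιd : HasFDerivAt (fun q => y (ι q)) ((fderiv ℝ y (t₀, 0)).comp ι') x :=
    hyD'.comp x hιd
  have hι'v : ∀ v : 𝔼 4, v 0 = 0 → ι' v = ContinuousLinearMap.inr ℝ ℝ (𝔼 3) (fibrePart v) := by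
    intro v hv
    refine Prod.ext ?_ ?_
    · simpa [hι'] using hv
    · simp [hι', hv]
  have hinj0 : ∀ v : 𝔼 4, v 0 = 0 → (fderiv ℝ y (t₀, 0)).comp ι' v = 0 → v = 0 := by
    intro v hv h
    rw [ContinuousLinearMap.comp_apply, hι'v v hv, ← ContinuousLinearMap.comp_apply, hyΛ] at h
    have hfp : fibrePart v = 0 := by
      apply Λ.injective
      rw [map_zero]
      exact h
    ext i
    refine Fin.cases ?_ (fun j => ?_) i
    · simpa using hv
    · have := congrArg (fun w : 𝔼 3 => w j) hfp
      simpa using this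
  have hFc : Continuous (fibredMap f) := (contDiff_fibredMap hf).continuous
  have hF0 : ∀ q ∈ O, fibredMap f q 0 = q 0 := fun q _ => fibredMap_apply_zero f q
  have hyιs : ContDiffOn ℝ ∞ (fun q => y (ι q)) O :=
    hys.comp (hιs.mono inter_subset_left) fun q hq => hq.2
  have hyιx : y (ι x) = 0 := by
    rw [hxι]
    exact hy0 t₀ hW₀
  -- Step 6: the two possible indices
  rcases (show σ = 1 ∨ σ = 2 by omega) with hσ' | hσ'
  · -- `σ = 1`: `g = -y₀² + y₁² + y₂²`; fibre coordinates `(y₁, y₂, y₀)`, `ε = 1`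
    refine hasIndefiniteFoldChart_of_fibreCoords hFc hOo hxO
      (Y := fun q => cycle3 (y (ι q))) (cycle3.contDiff.comp_contDiffOn hyιs)
      (by simp only [hyιx, map_zero]) (cycle3.hasFDerivAt.comp x hyιd)
      (fun v hv h => hinj0 v hv (cycle3_injective (by rwa [map_zero]))) hVo hOV hcs
      (ε := 1) (by norm_num) hF0 fun q hq => ?_
    rw [fibredMap_apply_one, hfq q hq, hgy (ι q) hq.2, hσ', sum_sq_filter_one, cycle3_apply]
    simp
    ring
  · -- `σ = 2`: `g = -y₀² - y₁² + y₂²`; fibre coordinates `y`, `ε = -1`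
    refine hasIndefiniteFoldChart_of_fibreCoords hFc hOo hxO (Y := fun q => y (ι q)) hyιs
      hyιx hyιd hinj0 hVo hOV hcs (ε := -1) (by norm_num) hF0 fun q hq => ?_
    rw [fibredMap_apply_one, hfq q hq, hgy (ι q) hq.2, hσ', sum_sq_filter_two]
    ring

end Literature.Topology.FourManifolds

end
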